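import Literature.NumberTheory.EllipticCurves.Tian2014.CongruentNumbersHeegnerPoints
import Literature.NumberTheory.EllipticCurves.BSDSelmerSmithTwoSelmerRankLaws
import HarnessLib

/-!
# Smith, *The distribution of `ℓ^∞`-Selmer groups in degree `ℓ` twist families I*, §1.2, Theorem 1.9:
# the `2^k`-class ranks of imaginary quadratic fields form a Markov chain (Gerth's heuristic)

A. Smith, J. Amer. Math. Soc. **39** (2026), no. 1, 1–72 (doi:10.1090/jams/1062) = arXiv:2207.05674v2
[Smi22a], §1.2 "Class groups and Cohen–Lenstra–Gerth heuristics" (REFEREED; wording of arXiv v2):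

> **Notation 1.7.** Given an imaginary quadratic field `K`, take `r_2(K) ≥ r_4(K) ≥ ⋯` to be the
> unique sequence of nonnegative integers satisfying
> `Cl K[2^∞] ≅ (ℤ/2ℤ)^{r_2(K) − r_4(K)} ⊕ (ℤ/4ℤ)^{r_4(K) − r_8(K)} ⊕ ⋯` and `lim_k r_{2^k}(K) = 0`.
>
> **Definition 1.8.** For `n ≥ j ≥ 0`, take `P^Mat(j | n)` to be the probability that a uniformly
> selected `n × n` matrix with entries in `𝔽_2` has kernel of rank exactly `j`. We also use the
> notation `P^Mat(j | ∞) = lim_{n → ∞} P^Mat(j | n)`.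
>
> **Theorem 1.9.** Given any nonincreasing sequence `r_4 ≥ r_8 ≥ ⋯ ≥ r_{2^k} ≥ ⋯` of nonnegative
> integers, we have
> `lim_{H → ∞} #{d ∈ ℤ^{>0} : d < H and r_{2^k}(ℚ(√−d)) = r_{2^k} for k ≥ 2} / H
>   = P^Mat(r_4 | ∞) · ∏_{k=3}^∞ P^Mat(r_{2^k} | r_{2^{k-1}})`.

("The distribution for `4`-class ranks was calculated by Fouvry and Klüners [Fouv07]. … It is the
third major result towards proving this heuristic for imaginary quadratic fields, after the result
of Davenport–Heilbronn on `3`-torsion and the result of Fouvry and Klüners on `4`-class ranks.")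
The `2^k`-class ranks of `ℚ(√−n)`, `ℚ(√−2n)` are the currency of the tree's congruent-number files
(Tian 2014 / Rédei–Reichardt: `Tian2014.fourTwoCard (Cl_K) = #(Cl² ∩ Cl[2]) = 2^{r_4(K)}`,
`Literature/NumberTheory/QuadraticFields/RedeiMatrixFourRank.lean`), whence the vocabulary below.

Transcription.
* `twoPowerClassRank k A = r_{2^k}(A)` for a multiplicatively written abelian group `A` (here
  `A = ClassGroup (𝓞 K)`), through `2^{r_{2^k}} = #(A^{2^{k-1}} ∩ A[2])` — the number of
  `2^{k-1}`-th powers of order dividing `2` (for finite `A ≅ ⊕ ℤ/2^{aᵢ} ⊕ (odd)` this set is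
  `⊕_{aᵢ ≥ k} ℤ/2`, so its size is `2^{#{i : aᵢ ≥ k}} = 2^{r_{2^k}}` in the sense of Notation 1.7);
  `r_{2^k} := log_2` of that cardinality. For `k = 2` the set is the tree's `fourTwoCard` set
  (`card_eq_fourTwoCard`).
* `P^Mat(j | n) = probKerDimMatrix n n j` (the tree's `m × n` kernel law of arXiv:2503.17619
  Notation 1.9, at `m = n`); `P^Mat(j | ∞)` and the infinite product enter, as in
  `smith2026_twoPowerSelmerRanks_markov`, through `Tendsto` hypotheses naming their values.
* "`ℚ(√−d)`" = any number field `K` with `[K : ℚ] = 2` containing a square root of `−d`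
  (`Tian2014.IsQuadraticFieldOfSqrt K (−d)`, the tree's idiom; `−d < 0` is not a rational square, so
  this is `ℚ(√−d)` up to isomorphism and the class group is determined); `d` runs over ALL positive
  integers `< H` (with repetitions of fields, as printed), `H` along `ℕ`.

Not transcribed: Notation 1.10 / Def. 1.11 / Thm. 1.12 (the `ω^k`-class ranks of the relative class
group `Cl K[ℓ^∞]/Cl K[ℓ^∞]^{Gal(K/F)}` as a `ℤ_ℓ[ξ]`-module in degree-`ℓ` families over a number
field `F`; no relative-class-group vocabulary in the tree).

## References

* [Smith2022SelmerTwistI] A. Smith, J. Amer. Math. Soc. 39 (2026) 1–72 = arXiv:2207.05674v2: §1.2,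
  Notation 1.7, Def. 1.8, Thm. 1.9 (arXiv p. 4).
* [Tian2014] Y. Tian, Camb. J. Math. 2 (2014): proof of Lemma 5.1 (`#(2𝒜 ∩ 𝒜[2]) = 2^{r_4}`).
-/

noncomputable section

open scoped Classical
open Filter Topology NumberField
open Literature.NumberTheory.EllipticCurves (probKerDimMatrix)
open Literature.NumberTheory.EllipticCurves.Tian2014 (IsQuadraticFieldOfSqrt fourTwoCard)

namespace Literature.NumberTheory.QuadraticFields

/-- **`2^{r_{2^k}(A)} = #(A^{2^{k-1}} ∩ A[2])`** for a multiplicatively written abelian group `A`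
(Smith, part I, Notation 1.7: `r_{2^k}` = the number of cyclic factors of `A[2^∞]` of order
`≥ 2^k`; Tian 2014, proof of Lemma 5.1 for `k = 2`: "multiplication by `2` induces
`𝒜[4]/𝒜[2] ≃ 𝒜[2] ∩ 2𝒜`"): the set of `2^{k-1}`-th powers whose square is trivial.
[cite: Smith2022SelmerTwistI, Notation 1.7] [cite: Tian2014, proof of Lemma 5.1] -/
def twoPowerClassRankCard (k : ℕ) (A : Type*) [CommGroup A] : ℕ :=
  Nat.card {a : A // (∃ b : A, b ^ (2 ^ (k - 1)) = a) ∧ a ^ 2 = 1}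

/-- **`r_{2^k}(A)`**, the `2^k`-rank (Smith, part I, Notation 1.7, for `A = Cl K`:
`Cl K[2^∞] ≅ (ℤ/2ℤ)^{r_2 − r_4} ⊕ (ℤ/4ℤ)^{r_4 − r_8} ⊕ ⋯`): `log_2 #(A^{2^{k-1}} ∩ A[2])`
(`twoPowerClassRankCard`; for a finite abelian group that set is an elementary abelian `2`-group of
rank `r_{2^k}`). [cite: Smith2022SelmerTwistI, Notation 1.7] -/
def twoPowerClassRank (k : ℕ) (A : Type*) [CommGroup A] : ℕ :=
  Nat.log 2 (twoPowerClassRankCard k A)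

/-- **Smith, J. Amer. Math. Soc. 39 (2026) 1–72 (part I), Theorem 1.9 (the `2^k`-class ranks of
imaginary quadratic fields form a Markov chain).** "Given any nonincreasing sequence
`r_4 ≥ r_8 ≥ ⋯ ≥ r_{2^k} ≥ ⋯` of nonnegative integers, we have
`lim_{H → ∞} #{d ∈ ℤ^{>0} : d < H and r_{2^k}(ℚ(√−d)) = r_{2^k} for k ≥ 2} / H
 = P^Mat(r_4 | ∞) · ∏_{k=3}^∞ P^Mat(r_{2^k} | r_{2^{k-1}})`."
Transcription: `r : ℕ → ℕ` read at `k ≥ 2` (`r k = r_{2^k}`), nonincreasing there;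
`r_{2^k}(ℚ(√−d))` = `twoPowerClassRank k (ClassGroup (𝓞 K))` for any (every) number field `K` with
`[K : ℚ] = 2` and `√−d ∈ K` (`IsQuadraticFieldOfSqrt K (−d)`); `P^Mat(j | n) = probKerDimMatrix n n j`
(Def. 1.8); `P^Mat(r_4 | ∞) = lim_n P^Mat(r_4 | n)` and the infinite product `∏_{k ≥ 3}` (limit of the
partial products over `3 ≤ k < n`) are the values `P₁`, `Pprod` named by the two `Tendsto`
hypotheses; `d < H` strict, `H` along `ℕ`. REFEREED (stated in part I, §1.2, among the
"consequences of the overarching theorem of this project" whose proofs "will be given in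
[Smi22b]"; part II: Thm. 2.14, non-self-dual Case 2.12 — `u = −r_2 − r_1' = 0` for imaginary
quadratic fields, Thm. 1.12 — and §3.3, Example 3.11).
[cite: Smith2022SelmerTwistI, Thm. 1.9 with Notation 1.7 and Def. 1.8] -/
def smith2026_twoPowerClassRanks_imaginaryQuadratic_markov : Prop :=
  ∀ (r : ℕ → ℕ), (∀ k, 2 ≤ k → r (k + 1) ≤ r k) →
    ∀ (P₁ Pprod : ℝ),
      Tendsto (fun n : ℕ ↦ probKerDimMatrix n n (r 2)) atTop (𝓝 P₁) →
      Tendsto (fun n : ℕ ↦ ∏ k ∈ Finset.Ico 3 n, probKerDimMatrix (r (k - 1)) (r (k - 1)) (r k))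
        atTop (𝓝 Pprod) →
      Tendsto (fun H : ℕ ↦
        (Nat.card {d : ℕ | 0 < d ∧ d < H ∧
            ∀ (K : Type) [Field K] [NumberField K], IsQuadraticFieldOfSqrt K (-(d : ℤ)) →
              ∀ k, 2 ≤ k → twoPowerClassRank k (ClassGroup (𝓞 K)) = r k} : ℝ) / H)
        atTop (𝓝 (P₁ * Pprod))

/-! ## API -/

/-- Unfolding `twoPowerClassRank`. [cite: Smith2022SelmerTwistI, Notation 1.7] -/
theorem twoPowerClassRank_eq (k : ℕ) (A : Type*) [CommGroup A] :
    twoPowerClassRank k A = Nat.log 2 (twoPowerClassRankCard k A) :=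
  rfl

/-- For `k = 2` the counting set is Tian's `#(𝒜² ∩ 𝒜[2])`: `twoPowerClassRankCard 2 A = fourTwoCard A`
(`2^{r_4}`). [cite: Tian2014, proof of Lemma 5.1] [cite: Smith2022SelmerTwistI, Notation 1.7] -/
theorem twoPowerClassRankCard_two (A : Type*) [CommGroup A] :
    twoPowerClassRankCard 2 A = fourTwoCard A := by
  unfold twoPowerClassRankCard fourTwoCard
  have h : ∀ a : A, ((∃ b : A, b ^ (2 ^ (2 - 1)) = a) ∧ a ^ 2 = 1) ↔ (IsSquare a ∧ a ^ 2 = 1) := by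
    intro a
    refine and_congr ⟨?_, ?_⟩ Iff.rfl
    · rintro ⟨b, rfl⟩
      exact ⟨b, by simp [pow_two]⟩
    · rintro ⟨b, hb⟩
      exact ⟨b, by simp [hb, pow_two]⟩
  exact Nat.card_congr (Equiv.subtypeEquivRight h)

/-- For `k = 1` the counting set is the full `2`-torsion `A[2]` (`2^{r_2} = #A[2]`).
[cite: Smith2022SelmerTwistI, Notation 1.7] -/
theorem twoPowerClassRankCard_one (A : Type*) [CommGroup A] :
    twoPowerClassRankCard 1 A = Nat.card {a : A // a ^ 2 = 1} := by
  unfold twoPowerClassRankCard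
  have h : ∀ a : A, ((∃ b : A, b ^ (2 ^ (1 - 1)) = a) ∧ a ^ 2 = 1) ↔ a ^ 2 = 1 := by
    intro a
    simp only [Nat.sub_self, pow_zero, pow_one, exists_eq, true_and]
  exact Nat.card_congr (Equiv.subtypeEquivRight h)

/-- The trivial class always lies in the counting set, so `twoPowerClassRankCard k A ≥ 1` for
finite `A`. [cite: Smith2022SelmerTwistI, Notation 1.7] -/
theorem one_le_twoPowerClassRankCard (k : ℕ) (A : Type*) [CommGroup A] [Finite A] :
    1 ≤ twoPowerClassRankCard k A := by
  unfold twoPowerClassRankCard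
  haveI : Nonempty {a : A // (∃ b : A, b ^ (2 ^ (k - 1)) = a) ∧ a ^ 2 = 1} :=
    ⟨⟨1, ⟨1, one_pow _⟩, one_pow _⟩⟩
  exact Nat.one_le_iff_ne_zero.mpr Nat.card_pos.ne'

end Literature.NumberTheory.QuadraticFields

end
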